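import Summits.AtomisticToContinuum.HydrodynamicLimit.Theses.JParityClosure

/-!
# `RateFloor` (stmt-AtomisticToContinuum-13080) — DOOR r1: the three candidate replacement texts, typed and checked
# (crux-strategist r1, `planner-cstrat-stmt-AtomisticToContinuum-13080-r1-0`, 2026-08-17)

Evidence / workfile, NOT a proposal (it declares `def`s; restating is a tenure-planner `route edit --restate`).
Companion of `Cruxes/RateFloor/STRATEGY-CENSUS.md` (r1) §8.  Nothing here concludes the FILED decl
`Theses.JParityClosure.RateFloor` except as a hypothesis of the weakening theorems.

* (A) `RateFloorGuarded` — the filed text moved into the route's OWN guarded frame, byte-identical to the frame of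
  the sibling crux `OddContactSymmetry` (stmt-17722, rev 5): `IsHardSphereEulerSolution σ T ρ u θ`, the conjunct's
  packing guard `ρ t x · σ³ < η₀` on `[0,T)`, flows with the `t = 0` LLN, horizon `0 < τ < T`; from `∀ χ` on the filed
  text verbatim.  NO anchor hypothesis.  `rateFloorGuarded_of_rateFloor`: it is a WEAKENING of the filed crux (rung 0
  p123815 and the 46 landed `--supports` files keep their value).  This is the SUMMIT-LIVE restatement (census §8 (A)).
* (A-PW) `RateFloorPWGuarded` — the same guarded frame in front of the POINTWISE-AT-SCALE-`r` body `RateFloorPW` (v3)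
  that the live closure line of the consumer crux 17608 (`Cruxes/ParityBandClosure/Lines/transfer_weighted_parity_chain.lean`,
  lead c2) actually consumes (tent-in-time windows of width `r²`, cone-in-space of width `r`, `(·)₊` INSIDE the
  `dt₀ dx₀` integral, reference products AFTER windowing).  `RateFloorPW_v3` is copied verbatim from that file (it is
  UNGUARDED there: `∀ Φ ∀ τ > 0`, no Euler solution, no LLN — census §1, finding F-r1-1); `rateFloorPWGuarded_of_PW`
  records that the guarded text is weaker, and `closes_guardedPW` that the route's deciding theorem keeps its one-line
  shape with crux 7 restated alongside (`ParityBandClosureGuardedPW`).  RECOMMENDED restatement (census §8).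
* (C) `RateFloorEntropyLipschitz` — the HYPOTHESIS-FREE, expectation-form floor: for EVERY initial probability law `P₀`,
  every flow family, every horizon `τ`, every dilute jointly-continuous local-Gibbs REFERENCE family `(a,u,θ)` on `[0,τ]`:
  `E_{P₀}[(g₀σ³∫₀^τ∫χB^Ξ_r − K_N[χΞ])₊] ≤ C(r,…) · sup_{s∈[0,τ]} klDiv(P₀∘Φ_s⁻¹ ‖ LG(a s,u s,θ s))/(N+1) + η` for `r < r₀`,
  `N ≥ N₀(η)`.  LINEAR in the entropy budget (floors are entropy-Lipschitz: every known deficit mechanism — lanes,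
  laminar shear, cold sorting — costs specific entropy proportional to the B-mass it silences; census §3 (C3) and
  ## Transfer T-c), true-looking at ALL times (post-shock the budget is `Δs > 0` and the bound is merely weak), and
  provable-looking from ONE-TIME STATICS under the reference (c11's S2″ plateau + S3″ isolated would-be lower tail at
  tilt `c(N+1)^{4/3}/σ`) + the landed sure inequality `lineSR_le_collisionFunctional` + the landed expectation-form
  entropy inequality (`KipnisLandim1999_A1_8_2_holds`).  It is NOT comparable with the filed crux; it is offered as a
  SUPPORT item (bankable), which proves every anchored form ((B) of the census: p1/c10/c11's R1/R2/R2″) by Markov and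
  gives (A) wherever the budget is known to vanish.

`lean check`: see the r1 census §8 for the rc / audit of this file.
-/

noncomputable section

open scoped BigOperators Topology ENNReal NNReal InnerProductSpace RealInnerProductSpace Classical
open MeasureTheory Set Filter Function

namespace Summit.AtomisticToContinuum.HydrodynamicLimit.Cruxes.RateFloor.DoorR1

open Summit.AtomisticToContinuum.HydrodynamicLimit.Theses.JParityClosure

/-- **(A) `RateFloorGuarded`** — proposed replacement text for `Theses.JParityClosure.RateFloor`: the route's own
guarded frame (verbatim the prefix of `OddContactSymmetry` 17722 rev 5, plus the conjunct's packing guard), then from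
`∀ χ` on the filed text verbatim.  No anchor. [folklore] -/
def RateFloorGuarded : Prop :=
  ∃ g₀ : ℝ, 0 < g₀ ∧ ∃ η₀ : ℝ, 0 < η₀ ∧ ∀ (a₀ θ₀ : Literature.MathematicalPhysics.KineticTheory.T3 → ℝ) (u₀ : Literature.MathematicalPhysics.KineticTheory.T3 → Literature.MathematicalPhysics.KineticTheory.V3), Continuous a₀ → Continuous θ₀ → Continuous u₀ → (∀ x, 0 < a₀ x) → (∀ x, 0 < θ₀ x) → ∃ σ₀ : ℝ, 0 < σ₀ ∧ ∀ σ : ℝ, 0 < σ → σ < σ₀ → ∀ (T : ℝ) (ρ θ : ℝ → Literature.MathematicalPhysics.KineticTheory.T3 → ℝ) (u : ℝ → Literature.MathematicalPhysics.KineticTheory.T3 → Literature.MathematicalPhysics.KineticTheory.V3), Literature.MathematicalPhysics.KineticTheory.IsHardSphereEulerSolution σ T ρ u θ → (∀ t ∈ Set.Ico 0 T, ∀ x, ρ t x * σ ^ 3 < η₀) → ∀ Φ : (N : ℕ) → Literature.Analysis.FluidPDE.HardSphereFlow (Literature.Analysis.FluidPDE.Torus.geometry (Fin 3)) (Literature.MathematicalPhysics.KineticTheory.hsDiameter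 σ N) (N + 1), Literature.MathematicalPhysics.KineticTheory.TendstoHydroFieldsAt (fun N => Literature.MathematicalPhysics.KineticTheory.localGibbsLaw σ a₀ u₀ θ₀ N (Φ N)) Φ ρ u θ 0 → ∀ τ : ℝ, 0 < τ → τ < T → ∀ χ : ℝ × UnitAddTorus (Fin 3) → ℝ, Continuous χ → (∀ p, 0 ≤ χ p) → ∀ Ξ : EuclideanSpace ℝ (Fin 3) × EuclideanSpace ℝ (Fin 3) × EuclideanSpace ℝ (Fin 3) → ℝ, Continuous Ξ → (∀ q, 0 ≤ Ξ q) → (∃ C : ℝ, ∀ q, Ξ q ≤ C) → ∀ η δ : ℝ, 0 < η → 0 < δ → ∃ r₀ : ℝ, 0 < r₀ ∧ ∀ r : ℝ, 0 < r → r < r₀ → ∃ N₀ : ℕ, ∀ N : ℕ, N₀ ≤ N → let ε := Literature.MathematicalPhysics.KineticTheory.hsDiameter σ N; let G := Literature.Analysis.FluidPDE.Torus.geometry (Fin 3); let γ := fun z (s : ℝ) => (Φ N).flow s z; let bx : UnitAddTorus (Fin 3) → UnitAddTorus (Fin 3) → ℝ := fun x y => 3 / (Real.pi * r ^ 3) *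 max (1 - Literature.Analysis.FluidPDE.Torus.euclidDist x y / r) 0; let Θ := fun (Ξ : EuclideanSpace ℝ (Fin 3) × EuclideanSpace ℝ (Fin 3) × EuclideanSpace ℝ (Fin 3) → ℝ) (v w : EuclideanSpace ℝ (Fin 3)) => ∫ ω : Metric.sphere (0 : EuclideanSpace ℝ (Fin 3)) 1, Ξ ((ω : EuclideanSpace ℝ (Fin 3)), v, w) * Literature.MathematicalPhysics.KineticTheory.hardSphereKernel (w, v) ω ∂Literature.MathematicalPhysics.KineticTheory.sphereMeasure; let B := fun Ξ z s (x₀ : UnitAddTorus (Fin 3)) => ∫ p, bx p.1.1 x₀ * bx p.2.1 x₀ * Θ Ξ p.1.2 p.2.2 ∂((Literature.Analysis.FluidPDE.empiricalMeasure (γ z s)).prod (Literature.Analysis.FluidPDE.empiricalMeasure (γ z s))); let pv := fun z s (i j : Fin (N + 1)) => Literature.Analysis.FluidPDE.reflectVel (G.sepVec (γ z s i).1 (γ z s j).1) ((γ z s i).2, (γ z s j).2); let Kc := fun (Fn : Literature.Analysis.FluidPDE.Config (N + 1) (Fin 3) Literature.MathematicalPhysics.KineticTheory.T3 → ℝ →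 Fin (N + 1) → Fin (N + 1) → ℝ) z => ε / (N + 1 : ℝ) * ∑ᶠ (s : ℝ) (_ : s ∈ Literature.Analysis.FluidPDE.collisionTimes G ε (γ z) ∩ Set.Icc 0 τ), ∑ i : Fin (N + 1), ∑ j : Fin (N + 1), (if i ≠ j ∧ ‖G.sepVec (γ z s i).1 (γ z s j).1‖ = ε then Fn z s i j else 0); Literature.MathematicalPhysics.KineticTheory.localGibbsLaw σ a₀ u₀ θ₀ N (Φ N) {z | Kc (fun z s i j => χ (s, (γ z s i).1) * Ξ (ε⁻¹ • G.sepVec (γ z s i).1 (γ z s j).1, (pv z s i j).1, (pv z s i j).2)) z < g₀ * σ ^ 3 * (∫ s in Set.Icc (0 : ℝ) τ, ∫ x : UnitAddTorus (Fin 3), χ (s, x) * B Ξ z s x) - η} ≤ ENNReal.ofReal δ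

/-- The guarded text is a weakening of the filed crux (drop the unused binders). [folklore] -/
theorem rateFloorGuarded_of_rateFloor (h : RateFloor) : RateFloorGuarded := by
  obtain ⟨g₀, hg₀, H⟩ := h
  refine ⟨g₀, hg₀, 1, one_pos, fun a₀ θ₀ u₀ ha hθ hu hap hθp => ?_⟩
  obtain ⟨σ₀, hσ₀, H1⟩ := H a₀ θ₀ u₀ ha hθ hu hap hθp
  exact ⟨σ₀, hσ₀, fun σ hσ hσ' T ρ θ u _ _ Φ _ τ hτ _ => H1 σ hσ hσ' Φ τ hτ⟩

/-- **`RateFloorPW_v3`** — VERBATIM copy of `RateFloorPW` from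
`Cruxes/ParityBandClosure/Lines/transfer_weighted_parity_chain.lean` (skeleton v3, lead c2 of crux 17608, 2026-08-17):
the pointwise-at-scale-`r`, two-time-product floor its `stub_kineticHalf` consumes.  NOTE (r1 finding): its frame is
the filed one — `∀ Φ, ∀ τ > 0`, no Euler solution, no `t = 0` LLN — so as an ITEM it would inherit the filed crux's
scope wall verbatim; only its BODY should be adopted. [folklore] -/
def RateFloorPW_v3 : Prop :=
  ∃ g₀ : ℝ, 0 < g₀ ∧ ∀ (a₀ θ₀ : Literature.MathematicalPhysics.KineticTheory.T3 → ℝ) (u₀ : Literature.MathematicalPhysics.KineticTheory.T3 → Literature.MathematicalPhysics.KineticTheory.V3), Continuous a₀ → Continuous θ₀ → Continuous u₀ → (∀ x, 0 < a₀ x) → (∀ x, 0 < θ₀ x) → ∃ σ₀ : ℝ, 0 < σ₀ ∧ ∀ σ : ℝ, 0 < σ → σ < σ₀ → ∀ Φ : (N : ℕ) → Literature.Analysis.FluidPDE.HardSphereFlow (Literature.Analysis.FluidPDE.Torus.geometry (Fin 3)) (Literature.MathematicalPhysics.KineticTheory.hsDiameter σ N) (N + 1), ∀ τ : ℝ, 0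 < τ → ∀ Ξ : EuclideanSpace ℝ (Fin 3) × EuclideanSpace ℝ (Fin 3) × EuclideanSpace ℝ (Fin 3) → ℝ, Continuous Ξ → (∀ q, 0 ≤ Ξ q) → (∃ C : ℝ, ∀ q, Ξ q ≤ C) → ∀ η δ : ℝ, 0 < η → 0 < δ → ∃ r₀ : ℝ, 0 < r₀ ∧ ∀ r : ℝ, 0 < r → r < r₀ → ∃ N₀ : ℕ, ∀ N : ℕ, N₀ ≤ N →
    let ε := Literature.MathematicalPhysics.KineticTheory.hsDiameter σ N
    let G : Literature.Analysis.FluidPDE.Geometry (Fin 3) Literature.MathematicalPhysics.KineticTheory.T3 := Literature.Analysis.FluidPDE.Torus.geometry (Fin 3)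
    let γ : Literature.Analysis.FluidPDE.Config (N + 1) (Fin 3) Literature.MathematicalPhysics.KineticTheory.T3 → ℝ → Literature.Analysis.FluidPDE.Config (N + 1) (Fin 3) Literature.MathematicalPhysics.KineticTheory.T3 := fun z s => (Φ N).flow s z
    let bx : Literature.MathematicalPhysics.KineticTheory.T3 → Literature.MathematicalPhysics.KineticTheory.T3 → ℝ := fun y x₀ => 3 / (Real.pi * r ^ 3) * max (1 - Literature.Analysis.FluidPDE.Torus.euclidDist y x₀ / r) 0
    let bt : ℝ → ℝ := fun a => (r ^ 2)⁻¹ * max (1 - |a| / r ^ 2) 0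
    let Θ : Literature.MathematicalPhysics.KineticTheory.V3 → Literature.MathematicalPhysics.KineticTheory.V3 → ℝ := fun v w =>
      ∫ ω : Metric.sphere (0 : Literature.MathematicalPhysics.KineticTheory.V3) 1, Ξ ((ω : Literature.MathematicalPhysics.KineticTheory.V3), v, w) * Literature.MathematicalPhysics.KineticTheory.hardSphereKernel (w, v) ω ∂Literature.MathematicalPhysics.KineticTheory.sphereMeasure
    let Bw : Literature.Analysis.FluidPDE.Config (N + 1) (Fin 3) Literature.MathematicalPhysics.KineticTheory.T3 → ℝ → Literature.MathematicalPhysics.KineticTheory.T3 → ℝ := fun z t₀ x₀ =>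
      ∫ s₁ in Set.Icc (0 : ℝ) τ, ∫ s₂ in Set.Icc (0 : ℝ) τ, bt (s₁ - t₀) * bt (s₂ - t₀) *
        ∫ p, bx p.1.1 x₀ * bx p.2.1 x₀ * Θ p.1.2 p.2.2 ∂((Literature.Analysis.FluidPDE.empiricalMeasure (γ z s₁)).prod (Literature.Analysis.FluidPDE.empiricalMeasure (γ z s₂)))
    let pv : Literature.Analysis.FluidPDE.Config (N + 1) (Fin 3) Literature.MathematicalPhysics.KineticTheory.T3 → ℝ → Fin (N + 1) → Fin (N + 1) → Literature.MathematicalPhysics.KineticTheory.V3 × Literature.MathematicalPhysics.KineticTheory.V3 := fun z s i j =>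
      Literature.Analysis.FluidPDE.reflectVel (G.sepVec (γ z s i).1 (γ z s j).1) ((γ z s i).2, (γ z s j).2)
    let Kw : Literature.Analysis.FluidPDE.Config (N + 1) (Fin 3) Literature.MathematicalPhysics.KineticTheory.T3 → ℝ → Literature.MathematicalPhysics.KineticTheory.T3 → ℝ := fun z t₀ x₀ =>
      ε / (N + 1 : ℝ) * ∑ᶠ (s : ℝ) (_ : s ∈ Literature.Analysis.FluidPDE.collisionTimes G ε (γ z) ∩ Set.Icc 0 τ),
        ∑ i : Fin (N + 1), ∑ j : Fin (N + 1),
          (if i ≠ j ∧ ‖G.sepVec (γ z s i).1 (γ z s j).1‖ = ε then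
            bt (s - t₀) * bx (γ z s i).1 x₀ *
              Ξ (ε⁻¹ • G.sepVec (γ z s i).1 (γ z s j).1, (pv z s i j).1, (pv z s i j).2) else 0)
    let D : Literature.Analysis.FluidPDE.Config (N + 1) (Fin 3) Literature.MathematicalPhysics.KineticTheory.T3 → ℝ := fun z =>
      ∫ t₀ in Set.Icc (0 : ℝ) τ, ∫ x₀ : Literature.MathematicalPhysics.KineticTheory.T3, max (g₀ * σ ^ 3 * Bw z t₀ x₀ - Kw z t₀ x₀) 0
    Literature.MathematicalPhysics.KineticTheory.localGibbsLaw σ a₀ u₀ θ₀ N (Φ N) {z | η < D z} ≤ ENNReal.ofReal δ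

/-- **(A-PW) `RateFloorPWGuarded`** — RECOMMENDED replacement text: the guarded frame of (A) in front of the body of
`RateFloorPW_v3` from `∀ Ξ` on, verbatim. [folklore] -/
def RateFloorPWGuarded : Prop :=
  ∃ g₀ : ℝ, 0 < g₀ ∧ ∃ η₀ : ℝ, 0 < η₀ ∧ ∀ (a₀ θ₀ : Literature.MathematicalPhysics.KineticTheory.T3 → ℝ) (u₀ : Literature.MathematicalPhysics.KineticTheory.T3 → Literature.MathematicalPhysics.KineticTheory.V3), Continuous a₀ → Continuous θ₀ → Continuous u₀ → (∀ x, 0 < a₀ x) → (∀ x, 0 < θ₀ x) → ∃ σ₀ : ℝ, 0 < σ₀ ∧ ∀ σ : ℝ, 0 < σ → σ < σ₀ → ∀ (T : ℝ) (ρ θ : ℝ → Literature.MathematicalPhysics.KineticTheory.T3 → ℝ) (u : ℝ → Literature.MathematicalPhysics.KineticTheory.T3 → Literature.MathematicalPhysics.KineticTheory.V3), Literature.MathematicalPhysics.KineticTheory.IsHardSphereEulerSolution σ T ρ u θ → (∀ t ∈ Set.Ico 0 T, ∀ x, ρ t x * σ ^ 3 < η₀) → ∀ Φ : (N : ℕ)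 → Literature.Analysis.FluidPDE.HardSphereFlow (Literature.Analysis.FluidPDE.Torus.geometry (Fin 3)) (Literature.MathematicalPhysics.KineticTheory.hsDiameter σ N) (N + 1), Literature.MathematicalPhysics.KineticTheory.TendstoHydroFieldsAt (fun N => Literature.MathematicalPhysics.KineticTheory.localGibbsLaw σ a₀ u₀ θ₀ N (Φ N)) Φ ρ u θ 0 → ∀ τ : ℝ, 0 < τ → τ < T → ∀ Ξ : EuclideanSpace ℝ (Fin 3) × EuclideanSpace ℝ (Fin 3) × EuclideanSpace ℝ (Fin 3) → ℝ, Continuous Ξ → (∀ q, 0 ≤ Ξ q) → (∃ C : ℝ, ∀ q, Ξ q ≤ C) → ∀ η δ : ℝ, 0 < η → 0 < δ → ∃ r₀ : ℝ, 0 < r₀ ∧ ∀ r : ℝ, 0 < r → r < r₀ → ∃ N₀ : ℕ, ∀ N : ℕ, N₀ ≤ N →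
    let ε := Literature.MathematicalPhysics.KineticTheory.hsDiameter σ N
    let G : Literature.Analysis.FluidPDE.Geometry (Fin 3) Literature.MathematicalPhysics.KineticTheory.T3 := Literature.Analysis.FluidPDE.Torus.geometry (Fin 3)
    let γ : Literature.Analysis.FluidPDE.Config (N + 1) (Fin 3) Literature.MathematicalPhysics.KineticTheory.T3 → ℝ → Literature.Analysis.FluidPDE.Config (N + 1) (Fin 3) Literature.MathematicalPhysics.KineticTheory.T3 := fun z s => (Φ N).flow s z
    let bx : Literature.MathematicalPhysics.KineticTheory.T3 → Literature.MathematicalPhysics.KineticTheory.T3 → ℝ := fun y x₀ => 3 / (Real.pi * r ^ 3) * max (1 - Literature.Analysis.FluidPDE.Torus.euclidDist y x₀ / r) 0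
    let bt : ℝ → ℝ := fun a => (r ^ 2)⁻¹ * max (1 - |a| / r ^ 2) 0
    let Θ : Literature.MathematicalPhysics.KineticTheory.V3 → Literature.MathematicalPhysics.KineticTheory.V3 → ℝ := fun v w =>
      ∫ ω : Metric.sphere (0 : Literature.MathematicalPhysics.KineticTheory.V3) 1, Ξ ((ω : Literature.MathematicalPhysics.KineticTheory.V3), v, w) * Literature.MathematicalPhysics.KineticTheory.hardSphereKernel (w, v) ω ∂Literature.MathematicalPhysics.KineticTheory.sphereMeasure
    let Bw : Literature.Analysis.FluidPDE.Config (N + 1) (Fin 3) Literature.MathematicalPhysics.KineticTheory.T3 → ℝ → Literature.MathematicalPhysics.KineticTheory.T3 → ℝ := fun z t₀ x₀ =>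
      ∫ s₁ in Set.Icc (0 : ℝ) τ, ∫ s₂ in Set.Icc (0 : ℝ) τ, bt (s₁ - t₀) * bt (s₂ - t₀) *
        ∫ p, bx p.1.1 x₀ * bx p.2.1 x₀ * Θ p.1.2 p.2.2 ∂((Literature.Analysis.FluidPDE.empiricalMeasure (γ z s₁)).prod (Literature.Analysis.FluidPDE.empiricalMeasure (γ z s₂)))
    let pv : Literature.Analysis.FluidPDE.Config (N + 1) (Fin 3) Literature.MathematicalPhysics.KineticTheory.T3 → ℝ → Fin (N + 1) → Fin (N + 1) → Literature.MathematicalPhysics.KineticTheory.V3 × Literature.MathematicalPhysics.KineticTheory.V3 := fun z s i j =>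
      Literature.Analysis.FluidPDE.reflectVel (G.sepVec (γ z s i).1 (γ z s j).1) ((γ z s i).2, (γ z s j).2)
    let Kw : Literature.Analysis.FluidPDE.Config (N + 1) (Fin 3) Literature.MathematicalPhysics.KineticTheory.T3 → ℝ → Literature.MathematicalPhysics.KineticTheory.T3 → ℝ := fun z t₀ x₀ =>
      ε / (N + 1 : ℝ) * ∑ᶠ (s : ℝ) (_ : s ∈ Literature.Analysis.FluidPDE.collisionTimes G ε (γ z) ∩ Set.Icc 0 τ),
        ∑ i : Fin (N + 1), ∑ j : Fin (N + 1),
          (if i ≠ j ∧ ‖G.sepVec (γ z s i).1 (γ z s j).1‖ = ε then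
            bt (s - t₀) * bx (γ z s i).1 x₀ *
              Ξ (ε⁻¹ • G.sepVec (γ z s i).1 (γ z s j).1, (pv z s i j).1, (pv z s i j).2) else 0)
    let D : Literature.Analysis.FluidPDE.Config (N + 1) (Fin 3) Literature.MathematicalPhysics.KineticTheory.T3 → ℝ := fun z =>
      ∫ t₀ in Set.Icc (0 : ℝ) τ, ∫ x₀ : Literature.MathematicalPhysics.KineticTheory.T3, max (g₀ * σ ^ 3 * Bw z t₀ x₀ - Kw z t₀ x₀) 0
    Literature.MathematicalPhysics.KineticTheory.localGibbsLaw σ a₀ u₀ θ₀ N (Φ N) {z | η < D z} ≤ ENNReal.ofReal δ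

/-- The guarded PW text is a weakening of the consumer line's unguarded `RateFloorPW` (drop the unused binders), so a
proof of the latter — should anyone obtain one — still serves. [folklore] -/
theorem rateFloorPWGuarded_of_PW (h : RateFloorPW_v3) : RateFloorPWGuarded := by
  obtain ⟨g₀, hg₀, H⟩ := h
  refine ⟨g₀, hg₀, 1, one_pos, fun a₀ θ₀ u₀ ha hθ hu hap hθp => ?_⟩
  obtain ⟨σ₀, hσ₀, H1⟩ := H a₀ θ₀ u₀ ha hθ hu hap hθp
  exact ⟨σ₀, hσ₀, fun σ hσ hσ' T ρ θ u _ _ Φ _ τ hτ _ => H1 σ hσ hσ' Φ τ hτ⟩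

/-- Crux 7 with its third hypothesis restated alongside (the closure line of 17608 consumes exactly this shape: its
`stub_kineticHalf` takes the PW floor, and every extra binder of the guard is available inside the proof of the
packing-guarded conjunct). [folklore] -/
def ParityBandClosureGuardedPW : Prop :=
  OddContactSymmetry → EvenStressEnskog → RateFloorPWGuarded → LocalSecondLaw → DensityCap → _root_.HydrodynamicLimit

/-- Shape of the deciding theorem after the restatement: still `h₇ h₂ h₃ h₄ h₅ h₆`. [folklore] -/
theorem closes_guardedPW (h₂ : OddContactSymmetry) (h₃ : EvenStressEnskog) (h₄ : RateFloorPWGuarded)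
    (h₅ : LocalSecondLaw) (h₆ : DensityCap) (h₇ : ParityBandClosureGuardedPW) : _root_.HydrodynamicLimit :=
  h₇ h₂ h₃ h₄ h₅ h₆

/-- **(C) `RateFloorEntropyLipschitz`** — the hypothesis-free, expectation-form, ENTROPY-LIPSCHITZ floor (census §8 (C),
## Transfer T-c).  Quantifier order: `∃ g₀ η₀ σ₁` universal; `∀ σ < σ₁, Φ, τ, χ ≥ 0, Ξ ≥ 0 bounded`; `∀` dilute
jointly-continuous reference family `(a, θ, u)` on `[0,τ]`; `∃ r₀ ∀ r < r₀ ∃ C ≥ 0 ∀ η > 0 ∃ N₀ ∀ N ≥ N₀ ∀ P₀`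
(probability law on `(N+1)`-particle phase space): the `P₀`-expectation of the positive part of the filed deficit
functional is at most `C ·` (the largest specific relative entropy, over `s ∈ [0,τ]`, of the time-`s` law
`P₀ ∘ Φ_s⁻¹` from the reference local Gibbs law `LG(a s, u s, θ s)`) `+ η`.  `C` may depend on `r` (the B-side plateau
constant degrades as `r → 0`; harmless in a Grönwall started from zero budget at fixed `r`), never on `P₀`.  With
`klDiv = ⊤` the bound is trivial, as it should be.  Filed deficit functional, `Θ`, `B`, `pv`, `Kc` VERBATIM the route
decl. [folklore] -/
def RateFloorEntropyLipschitz : Prop :=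
  ∃ g₀ : ℝ, 0 < g₀ ∧ ∃ η₀ : ℝ, 0 < η₀ ∧ ∃ σ₁ : ℝ, 0 < σ₁ ∧ ∀ σ : ℝ, 0 < σ → σ < σ₁ → ∀ Φ : (N : ℕ) → Literature.Analysis.FluidPDE.HardSphereFlow (Literature.Analysis.FluidPDE.Torus.geometry (Fin 3)) (Literature.MathematicalPhysics.KineticTheory.hsDiameter σ N) (N + 1), ∀ τ : ℝ, 0 < τ → ∀ χ : ℝ × UnitAddTorus (Fin 3) → ℝ, Continuous χ → (∀ p, 0 ≤ χ p) → ∀ Ξ : EuclideanSpace ℝ (Fin 3) × EuclideanSpace ℝ (Fin 3) × EuclideanSpace ℝ (Fin 3) → ℝ, Continuous Ξ → (∀ q, 0 ≤ Ξ q) → (∃ C : ℝ, ∀ q, Ξ q ≤ C) → ∀ (a θ : ℝ → Literature.MathematicalPhysics.KineticTheory.T3 → ℝ) (u : ℝ → Literature.MathematicalPhysics.KineticTheory.T3 → Literature.MathematicalPhysics.KineticTheory.V3), ContinuousOn (Function.uncurry a) (Set.Icc (0 : ℝ) τ ×ˢ Set.univ) → ContinuousOn (Function.uncurry θ) (Set.Icc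 (0 : ℝ) τ ×ˢ Set.univ) → ContinuousOn (Function.uncurry u) (Set.Icc (0 : ℝ) τ ×ˢ Set.univ) → (∀ s ∈ Set.Icc (0 : ℝ) τ, ∀ x, 0 < a s x) → (∀ s ∈ Set.Icc (0 : ℝ) τ, ∀ x, 0 < θ s x) → (∀ s ∈ Set.Icc (0 : ℝ) τ, ∀ x, a s x * σ ^ 3 ≤ η₀ * ∫ y, a s y) → ∃ r₀ : ℝ, 0 < r₀ ∧ ∀ r : ℝ, 0 < r → r < r₀ → ∃ C : ℝ, 0 ≤ C ∧ ∀ η : ℝ, 0 < η → ∃ N₀ : ℕ, ∀ N : ℕ, N₀ ≤ N → ∀ P₀ : MeasureTheory.Measure (Literature.Analysis.FluidPDE.Config (N + 1) (Fin 3) Literature.MathematicalPhysics.KineticTheory.T3), MeasureTheory.IsProbabilityMeasure P₀ → let ε := Literature.MathematicalPhysics.KineticTheory.hsDiameter σ N; let G := Literature.Analysis.FluidPDE.Torus.geometry (Fin 3); let γ := fun z (s : ℝ) => (Φ N).flow s z; let bx : UnitAddTorus (Fin 3) → UnitAddTorus (Fin 3) → ℝ := fun x y => 3 / (Real.pi *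 r ^ 3) * max (1 - Literature.Analysis.FluidPDE.Torus.euclidDist x y / r) 0; let Θ := fun (Ξ : EuclideanSpace ℝ (Fin 3) × EuclideanSpace ℝ (Fin 3) × EuclideanSpace ℝ (Fin 3) → ℝ) (v w : EuclideanSpace ℝ (Fin 3)) => ∫ ω : Metric.sphere (0 : EuclideanSpace ℝ (Fin 3)) 1, Ξ ((ω : EuclideanSpace ℝ (Fin 3)), v, w) * Literature.MathematicalPhysics.KineticTheory.hardSphereKernel (w, v) ω ∂Literature.MathematicalPhysics.KineticTheory.sphereMeasure; let B := fun Ξ z s (x₀ : UnitAddTorus (Fin 3)) => ∫ p, bx p.1.1 x₀ * bx p.2.1 x₀ * Θ Ξ p.1.2 p.2.2 ∂((Literature.Analysis.FluidPDE.empiricalMeasure (γ z s)).prod (Literature.Analysis.FluidPDE.empiricalMeasure (γ z s))); let pv := fun z s (i j : Fin (N + 1)) => Literature.Analysis.FluidPDE.reflectVel (G.sepVec (γ z s i).1 (γ z s j).1) ((γ z s i).2, (γ z s j).2); let Kc := fun (Fn : Literature.Analysis.FluidPDE.Config (N + 1) (Fin 3) Literature.MathematicalPhysics.KineticTheory.T3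 → ℝ → Fin (N + 1) → Fin (N + 1) → ℝ) z => ε / (N + 1 : ℝ) * ∑ᶠ (s : ℝ) (_ : s ∈ Literature.Analysis.FluidPDE.collisionTimes G ε (γ z) ∩ Set.Icc 0 τ), ∑ i : Fin (N + 1), ∑ j : Fin (N + 1), (if i ≠ j ∧ ‖G.sepVec (γ z s i).1 (γ z s j).1‖ = ε then Fn z s i j else 0); let D := fun z => max (g₀ * σ ^ 3 * (∫ s in Set.Icc (0 : ℝ) τ, ∫ x : UnitAddTorus (Fin 3), χ (s, x) * B Ξ z s x) - Kc (fun z s i j => χ (s, (γ z s i).1) * Ξ (ε⁻¹ • G.sepVec (γ z s i).1 (γ z s j).1, (pv z s i j).1, (pv z s i j).2)) z) 0; let bud : ENNReal := ⨆ s ∈ Set.Icc (0 : ℝ) τ, InformationTheory.klDiv (P₀.map ((Φ N).flow s)) (Literature.MathematicalPhysics.KineticTheory.localGibbsLaw σ (a s) (u s) (θ s) N (Φ N)); (∫⁻ z, ENNReal.ofReal (D z) ∂P₀) ≤ ENNReal.ofReal C * bud / ((N : ENNReal) + 1) + ENNReal.ofReal η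

end Summit.AtomisticToContinuum.HydrodynamicLimit.Cruxes.RateFloor.DoorR1

end
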